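import Mathlib
import HarnessLib
import Summits.QuantumFields.YangMills.Theorems.ComplexCouplingChannelContinuumLegGivenGapProductToUniformGevreyGlue

/-!
# `ContinuumLegGivenGap` (stmt-QuantumFields-15828), line `alternating-curvature-arrays`: `stub_productToUniform`, helper P4c — a smooth STEP function of Gevrey class 2 with explicit constants

Support file for the Whitney / grid-shift / nuclear step `stub_productToUniform` ((PB) ⇒ (UUVB)).  The smooth partitions of
unity of the Whitney bookkeeping (level selectors, offset weights, core cut-offs) are all built from ONE one-dimensional
profile: a smooth step `θ`, `= 0` on `(-∞, 0]`, `= 1` on `[1, ∞)`, `0 ≤ θ ≤ 1`, whose derivatives of ALL orders are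
explicitly factorially bounded — the Schwartz norm of order `p·t` of a localised piece differentiates the profile up to
`p·t` times, and only such bounds keep the (UUVB) shape `α^p (p!)^β`.  Mathlib's `Real.smoothTransition` is a QUOTIENT of
glue functions (no usable high-order bounds); here `θ` is the normalised PRIMITIVE of the Gevrey-2 density
`w(t) = expNegInvGlue t · expNegInvGlue (1 - t)` (helper P4b: `|expNegInvGlue⁽ⁿ⁾| ≤ 9ⁿ (n!)²`):

* §1 the density: smooth, `≥ 0`, `= 0` off `(0, 1)`, `≥ e⁻⁸` on `[1/4, 3/4]`, and `|w⁽ⁿ⁾| ≤ 18ⁿ (n!)²` (Leibniz);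
* §2 its primitive `P(x) = ∫₀ˣ w`: `P' = w`, smooth, `= 0` on `x ≤ 0`, `= P(1)` on `x ≥ 1`, monotone, `P(1) ≥ e⁻⁸/2`;
* §3 `gstep_exists` (registered anchor): a function `θ` (namely `P/P(1)`) with `ContDiff ℝ ∞ θ`, `θ = 0` on `x ≤ 0`,
  `θ = 1` on `x ≥ 1`, `0 ≤ θ ≤ 1`, monotone, and `|θ⁽ⁿ⁾(x)| ≤ 2¹⁴ · 18ⁿ (n!)²` for all `n, x` (`2e⁸ ≤ 2¹⁴`).

One-variable calculus; Mathlib + helper P4b only; no definitions (the step is delivered existentially). [folklore]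
-/

set_option autoImplicit false

noncomputable section

namespace Summit.QuantumFields.YangMills.Theorems.ContinuumLegGivenGap

open Set Filter Topology MeasureTheory intervalIntegral
open scoped ContDiff

/-! ## §1 The density `w(t) = expNegInvGlue t · expNegInvGlue (1 - t)` -/

/-- The density is smooth. [folklore] -/
theorem gstep_density_contDiff : ContDiff ℝ ∞ (fun t : ℝ => expNegInvGlue t * expNegInvGlue (1 - t)) :=
  expNegInvGlue.contDiff.mul (expNegInvGlue.contDiff.comp (contDiff_const.sub contDiff_id))

/-- The density is continuous. [folklore] -/
theorem gstep_density_continuous : Continuous (fun t : ℝ => expNegInvGlue t * expNegInvGlue (1 - t)) :=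
  gstep_density_contDiff.continuous

/-- The density is non-negative. [folklore] -/
theorem gstep_density_nonneg (t : ℝ) : 0 ≤ expNegInvGlue t * expNegInvGlue (1 - t) :=
  mul_nonneg (expNegInvGlue.nonneg t) (expNegInvGlue.nonneg _)

/-- The density vanishes on `t ≤ 0`. [folklore] -/
theorem gstep_density_zero_of_nonpos {t : ℝ} (ht : t ≤ 0) : expNegInvGlue t * expNegInvGlue (1 - t) = 0 := by
  rw [expNegInvGlue.zero_of_nonpos ht, zero_mul]

/-- The density vanishes on `1 ≤ t`. [folklore] -/
theorem gstep_density_zero_of_one_le {t : ℝ} (ht : 1 ≤ t) : expNegInvGlue t * expNegInvGlue (1 - t) = 0 := by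
  rw [expNegInvGlue.zero_of_nonpos (by linarith : 1 - t ≤ 0), mul_zero]

/-- The density is positive on `(0, 1)`. [folklore] -/
theorem gstep_density_pos {t : ℝ} (ht : t ∈ Ioo (0 : ℝ) 1) : 0 < expNegInvGlue t * expNegInvGlue (1 - t) :=
  mul_pos (expNegInvGlue.pos_of_pos ht.1) (expNegInvGlue.pos_of_pos (by linarith [ht.2]))

/-- On `[1/4, 3/4]` the density is at least `e⁻⁸` (`expNegInvGlue` is monotone and `expNegInvGlue (1/4) = e⁻⁴`).
[folklore] -/
theorem gstep_density_ge {t : ℝ} (ht : t ∈ Icc (1 / 4 : ℝ) (3 / 4)) :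
    Real.exp (-8) ≤ expNegInvGlue t * expNegInvGlue (1 - t) := by
  have hq : expNegInvGlue (1 / 4) = Real.exp (-4) := by
    rw [gevrey_expNegInvGlue_of_pos (by norm_num)]; norm_num
  have h1 : Real.exp (-4) ≤ expNegInvGlue t := by rw [← hq]; exact expNegInvGlue.monotone ht.1
  have h2 : Real.exp (-4) ≤ expNegInvGlue (1 - t) := by
    rw [← hq]; exact expNegInvGlue.monotone (by linarith [ht.2])
  calc Real.exp (-8) = Real.exp (-4) * Real.exp (-4) := by rw [← Real.exp_add]; norm_num
    _ ≤ expNegInvGlue t * expNegInvGlue (1 - t) :=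
        mul_le_mul h1 h2 (Real.exp_pos _).le (expNegInvGlue.nonneg t)

/-- Derivatives of the reflected glue `t ↦ expNegInvGlue (1 - t)`: `|Dʲ| ≤ 9ʲ (j!)²`. [folklore] -/
theorem gstep_abs_iteratedDeriv_reflect_le (j : ℕ) (x : ℝ) :
    |iteratedDeriv j (fun t : ℝ => expNegInvGlue (1 - t)) x| ≤ 9 ^ j * (j.factorial : ℝ) ^ 2 := by
  have h := congrFun (iteratedDeriv_comp_const_sub (n := j) (f := expNegInvGlue) (s := (1 : ℝ))) x
  rw [h, smul_eq_mul, abs_mul, abs_pow, abs_neg, abs_one, one_pow, one_mul]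
  exact gevrey_abs_iteratedDeriv_expNegInvGlue_le j (1 - x)

/-- **The density is Gevrey-2**: `|w⁽ⁿ⁾(x)| ≤ 18ⁿ (n!)²` (Leibniz; `C(n,i) (i!)² ((n-i)!)² = n! · i!(n-i)! ≤ (n!)²`,
`n + 1 ≤ 2ⁿ`). [folklore] -/
theorem gstep_density_abs_iteratedDeriv_le (n : ℕ) (x : ℝ) :
    |iteratedDeriv n (fun t : ℝ => expNegInvGlue t * expNegInvGlue (1 - t)) x| ≤ 18 ^ n * (n.factorial : ℝ) ^ 2 := by
  have hu : ContDiff ℝ ∞ expNegInvGlue := expNegInvGlue.contDiff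
  have hv : ContDiff ℝ ∞ (fun t : ℝ => expNegInvGlue (1 - t)) :=
    expNegInvGlue.contDiff.comp (contDiff_const.sub contDiff_id)
  have hLeib := norm_iteratedFDeriv_mul_le (𝕜 := ℝ) (N := ∞) hu hv x (n := n) (mod_cast le_top)
  rw [← Real.norm_eq_abs, ← norm_iteratedFDeriv_eq_norm_iteratedDeriv]
  refine hLeib.trans ?_
  have hterm : ∀ i ∈ Finset.range (n + 1),
      (n.choose i : ℝ) * ‖iteratedFDeriv ℝ i expNegInvGlue x‖ *
        ‖iteratedFDeriv ℝ (n - i) (fun t : ℝ => expNegInvGlue (1 - t)) x‖ ≤ 9 ^ n * (n.factorial : ℝ) ^ 2 := by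
    intro i hi
    have hin : i ≤ n := Nat.lt_succ_iff.1 (Finset.mem_range.1 hi)
    have h1 : ‖iteratedFDeriv ℝ i expNegInvGlue x‖ ≤ 9 ^ i * (i.factorial : ℝ) ^ 2 :=
      gevrey_norm_iteratedFDeriv_expNegInvGlue_le i x
    have h2 : ‖iteratedFDeriv ℝ (n - i) (fun t : ℝ => expNegInvGlue (1 - t)) x‖ ≤
        9 ^ (n - i) * ((n - i).factorial : ℝ) ^ 2 := by
      rw [norm_iteratedFDeriv_eq_norm_iteratedDeriv, Real.norm_eq_abs]
      exact gstep_abs_iteratedDeriv_reflect_le (n - i) x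
    -- the combinatorial identity and bound
    have hcomb : (n.choose i : ℝ) * (i.factorial : ℝ) ^ 2 * ((n - i).factorial : ℝ) ^ 2 ≤ (n.factorial : ℝ) ^ 2 := by
      have hid : (n.choose i : ℝ) * i.factorial * (n - i).factorial = n.factorial := by
        exact_mod_cast Nat.choose_mul_factorial_mul_factorial hin
      have hle : (i.factorial : ℝ) * (n - i).factorial ≤ n.factorial := by
        have h := Nat.le_of_dvd (Nat.factorial_pos n) (Nat.factorial_mul_factorial_dvd_factorial hin)
        exact_mod_cast h
      have h0 : (0 : ℝ) ≤ (n.choose i : ℝ) * i.factorial * (n - i).factorial := by positivity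
      calc (n.choose i : ℝ) * (i.factorial : ℝ) ^ 2 * ((n - i).factorial : ℝ) ^ 2
          = ((n.choose i : ℝ) * i.factorial * (n - i).factorial) * (i.factorial * (n - i).factorial) := by ring
        _ ≤ (n.factorial : ℝ) * n.factorial := by rw [hid]; exact mul_le_mul_of_nonneg_left hle (Nat.cast_nonneg _)
        _ = (n.factorial : ℝ) ^ 2 := by ring
    have hpow : (9 : ℝ) ^ i * 9 ^ (n - i) = 9 ^ n := by rw [← pow_add, Nat.add_sub_cancel' hin]
    calc (n.choose i : ℝ) * ‖iteratedFDeriv ℝ i expNegInvGlue x‖ *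
          ‖iteratedFDeriv ℝ (n - i) (fun t : ℝ => expNegInvGlue (1 - t)) x‖
        ≤ (n.choose i : ℝ) * (9 ^ i * (i.factorial : ℝ) ^ 2) * (9 ^ (n - i) * ((n - i).factorial : ℝ) ^ 2) := by
          gcongr
      _ = (9 ^ i * 9 ^ (n - i)) * ((n.choose i : ℝ) * (i.factorial : ℝ) ^ 2 * ((n - i).factorial : ℝ) ^ 2) := by
          ring
      _ ≤ 9 ^ n * (n.factorial : ℝ) ^ 2 := by
          rw [hpow]; exact mul_le_mul_of_nonneg_left hcomb (by positivity)
  calc ∑ i ∈ Finset.range (n + 1), (n.choose i : ℝ) * ‖iteratedFDeriv ℝ i expNegInvGlue x‖ *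
        ‖iteratedFDeriv ℝ (n - i) (fun t : ℝ => expNegInvGlue (1 - t)) x‖
      ≤ ∑ _i ∈ Finset.range (n + 1), (9 : ℝ) ^ n * (n.factorial : ℝ) ^ 2 := Finset.sum_le_sum hterm
    _ = (n + 1) * (9 ^ n * (n.factorial : ℝ) ^ 2) := by rw [Finset.sum_const, Finset.card_range, nsmul_eq_mul]; push_cast; ring
    _ ≤ 2 ^ n * (9 ^ n * (n.factorial : ℝ) ^ 2) := by
        refine mul_le_mul_of_nonneg_right ?_ (by positivity)
        have h2 : n + 1 ≤ 2 ^ n := Nat.lt_two_pow_self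
        exact_mod_cast h2
    _ = 18 ^ n * (n.factorial : ℝ) ^ 2 := by
        rw [← mul_assoc, ← mul_pow]; norm_num

/-! ## §2 The primitive `P(x) = ∫₀ˣ w` -/

/-- `P' = w`. [folklore] -/
theorem gstep_prim_hasDerivAt (x : ℝ) :
    HasDerivAt (fun u : ℝ => ∫ t in (0 : ℝ)..u, expNegInvGlue t * expNegInvGlue (1 - t))
      (expNegInvGlue x * expNegInvGlue (1 - x)) x :=
  (gstep_density_continuous.integral_hasStrictDerivAt 0 x).hasDerivAt

/-- `deriv P = w`. [folklore] -/
theorem gstep_prim_deriv :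
    deriv (fun u : ℝ => ∫ t in (0 : ℝ)..u, expNegInvGlue t * expNegInvGlue (1 - t)) =
      fun x => expNegInvGlue x * expNegInvGlue (1 - x) :=
  funext fun x => (gstep_prim_hasDerivAt x).deriv

/-- `P` is smooth. [folklore] -/
theorem gstep_prim_contDiff : ContDiff ℝ ∞ (fun u : ℝ => ∫ t in (0 : ℝ)..u, expNegInvGlue t * expNegInvGlue (1 - t)) := by
  rw [contDiff_infty_iff_deriv, gstep_prim_deriv]
  exact ⟨fun x => (gstep_prim_hasDerivAt x).differentiableAt, gstep_density_contDiff⟩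

/-- `P = 0` on `x ≤ 0`. [folklore] -/
theorem gstep_prim_of_nonpos {x : ℝ} (hx : x ≤ 0) :
    ∫ t in (0 : ℝ)..x, expNegInvGlue t * expNegInvGlue (1 - t) = 0 := by
  rw [integral_congr (g := fun _ => (0 : ℝ)) fun t ht => ?_, intervalIntegral.integral_zero]
  rw [uIcc_of_ge hx] at ht
  exact gstep_density_zero_of_nonpos ht.2

/-- `P = P(1)` on `1 ≤ x`. [folklore] -/
theorem gstep_prim_of_one_le {x : ℝ} (hx : 1 ≤ x) :
    ∫ t in (0 : ℝ)..x, expNegInvGlue t * expNegInvGlue (1 - t) =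
      ∫ t in (0 : ℝ)..1, expNegInvGlue t * expNegInvGlue (1 - t) := by
  have hint : ∀ a b : ℝ, IntervalIntegrable (fun t : ℝ => expNegInvGlue t * expNegInvGlue (1 - t)) volume a b :=
    fun a b => gstep_density_continuous.intervalIntegrable a b
  rw [← integral_add_adjacent_intervals (hint 0 1) (hint 1 x)]
  have h0 : ∫ t in (1 : ℝ)..x, expNegInvGlue t * expNegInvGlue (1 - t) = 0 := by
    rw [integral_congr (g := fun _ => (0 : ℝ)) fun t ht => ?_, intervalIntegral.integral_zero]
    rw [uIcc_of_le hx] at ht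
    exact gstep_density_zero_of_one_le ht.1
  rw [h0, add_zero]

/-- `P` is monotone. [folklore] -/
theorem gstep_prim_monotone : Monotone (fun u : ℝ => ∫ t in (0 : ℝ)..u, expNegInvGlue t * expNegInvGlue (1 - t)) :=
  monotone_of_deriv_nonneg (fun x => (gstep_prim_hasDerivAt x).differentiableAt) fun x => by
    rw [gstep_prim_deriv]; exact gstep_density_nonneg x

/-- `0 ≤ P ≤ P(1)`. [folklore] -/
theorem gstep_prim_mem (x : ℝ) :
    0 ≤ ∫ t in (0 : ℝ)..x, expNegInvGlue t * expNegInvGlue (1 - t) ∧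
      ∫ t in (0 : ℝ)..x, expNegInvGlue t * expNegInvGlue (1 - t) ≤
        ∫ t in (0 : ℝ)..1, expNegInvGlue t * expNegInvGlue (1 - t) := by
  constructor
  · rcases le_or_gt x 0 with hx | hx
    · rw [gstep_prim_of_nonpos hx]
    · have h := gstep_prim_monotone hx.le
      simp only [intervalIntegral.integral_same] at h
      exact h
  · rcases le_or_gt 1 x with hx | hx
    · rw [gstep_prim_of_one_le hx]
    · exact gstep_prim_monotone hx.le

/-- `P(1) ≥ e⁻⁸/2` (the density is `≥ e⁻⁸` on `[1/4, 3/4]`). [folklore] -/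
theorem gstep_prim_one_ge :
    Real.exp (-8) / 2 ≤ ∫ t in (0 : ℝ)..1, expNegInvGlue t * expNegInvGlue (1 - t) := by
  have hint : IntervalIntegrable (fun t : ℝ => expNegInvGlue t * expNegInvGlue (1 - t)) volume 0 1 :=
    gstep_density_continuous.intervalIntegrable 0 1
  calc Real.exp (-8) / 2 = ∫ _t in (1 / 4 : ℝ)..(3 / 4), Real.exp (-8) := by
        rw [intervalIntegral.integral_const, smul_eq_mul]; ring
    _ ≤ ∫ t in (1 / 4 : ℝ)..(3 / 4), expNegInvGlue t * expNegInvGlue (1 - t) :=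
        integral_mono_on (by norm_num) intervalIntegrable_const (gstep_density_continuous.intervalIntegrable _ _)
          fun t ht => gstep_density_ge ht
    _ ≤ ∫ t in (0 : ℝ)..1, expNegInvGlue t * expNegInvGlue (1 - t) :=
        integral_mono_interval (by norm_num) (by norm_num) (by norm_num)
          (Eventually.of_forall fun t => gstep_density_nonneg t) hint

/-- `P(1) > 0`. [folklore] -/
theorem gstep_prim_one_pos : 0 < ∫ t in (0 : ℝ)..1, expNegInvGlue t * expNegInvGlue (1 - t) :=
  lt_of_lt_of_le (by positivity) gstep_prim_one_ge

/-- The normalising constant is at most `2¹⁴`: `P(1)⁻¹ ≤ 2 e⁸ ≤ 2 · 3⁸ ≤ 2¹⁴`. [folklore] -/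
theorem gstep_inv_prim_one_le : (∫ t in (0 : ℝ)..1, expNegInvGlue t * expNegInvGlue (1 - t))⁻¹ ≤ 2 ^ 14 := by
  have h := gstep_prim_one_ge
  have hpos : 0 < Real.exp (-8) / 2 := by positivity
  calc (∫ t in (0 : ℝ)..1, expNegInvGlue t * expNegInvGlue (1 - t))⁻¹ ≤ (Real.exp (-8) / 2)⁻¹ :=
        inv_anti₀ hpos h
    _ = 2 * Real.exp 8 := by rw [Real.exp_neg]; field_simp
    _ ≤ 2 * 3 ^ 8 := by
        have h1 : Real.exp 1 < 3 := lt_trans Real.exp_one_lt_d9 (by norm_num)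
        have h8 : Real.exp 8 = Real.exp 1 ^ 8 := by rw [← Real.exp_nat_mul]; norm_num
        rw [h8]
        have := pow_le_pow_left₀ (Real.exp_pos 1).le h1.le 8
        linarith
    _ ≤ 2 ^ 14 := by norm_num

/-! ## §3 The Gevrey step -/

/-- **A smooth step of Gevrey class 2 with explicit constants** (registered anchor): there is `θ : ℝ → ℝ`, smooth,
`= 0` on `(-∞, 0]`, `= 1` on `[1, ∞)`, with values in `[0, 1]`, monotone, and `|θ⁽ⁿ⁾(x)| ≤ 2¹⁴ · 18ⁿ (n!)²` for all
`n` and `x` (namely `θ = P/P(1)`, `P` the primitive of `expNegInvGlue t · expNegInvGlue (1 - t)`). [folklore] -/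
theorem gstep_exists : ∃ θ : ℝ → ℝ, ContDiff ℝ ∞ θ ∧ (∀ x, x ≤ 0 → θ x = 0) ∧ (∀ x, 1 ≤ x → θ x = 1) ∧
    (∀ x, 0 ≤ θ x ∧ θ x ≤ 1) ∧ Monotone θ ∧
    ∀ (n : ℕ) (x : ℝ), |iteratedDeriv n θ x| ≤ 2 ^ 14 * 18 ^ n * (n.factorial : ℝ) ^ 2 := by
  set I : ℝ := ∫ t in (0 : ℝ)..1, expNegInvGlue t * expNegInvGlue (1 - t) with hI
  set P : ℝ → ℝ := fun u => ∫ t in (0 : ℝ)..u, expNegInvGlue t * expNegInvGlue (1 - t) with hP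
  have hI0 : 0 < I := gstep_prim_one_pos
  have hIinv : 0 ≤ I⁻¹ := inv_nonneg.2 hI0.le
  refine ⟨fun x => I⁻¹ * P x, contDiff_const.mul gstep_prim_contDiff, fun x hx => ?_, fun x hx => ?_, fun x => ?_,
    fun x y hxy => mul_le_mul_of_nonneg_left (gstep_prim_monotone hxy) hIinv, fun n x => ?_⟩
  · show I⁻¹ * P x = 0
    rw [hP]; dsimp only; rw [gstep_prim_of_nonpos hx, mul_zero]
  · show I⁻¹ * P x = 1
    rw [hP]; dsimp only; rw [gstep_prim_of_one_le hx, ← hI, inv_mul_cancel₀ hI0.ne']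
  · obtain ⟨h0, h1⟩ := gstep_prim_mem x
    refine ⟨mul_nonneg hIinv h0, ?_⟩
    calc I⁻¹ * P x ≤ I⁻¹ * I := mul_le_mul_of_nonneg_left h1 hIinv
      _ = 1 := inv_mul_cancel₀ hI0.ne'
  · rw [iteratedDeriv_const_mul_field, abs_mul, abs_of_nonneg hIinv]
    cases n with
    | zero =>
      rw [iteratedDeriv_zero]
      obtain ⟨h0, h1⟩ := gstep_prim_mem x
      rw [abs_of_nonneg h0]
      calc I⁻¹ * P x ≤ I⁻¹ * I := mul_le_mul_of_nonneg_left h1 hIinv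
        _ = 1 := inv_mul_cancel₀ hI0.ne'
        _ ≤ 2 ^ 14 * 18 ^ 0 * ((0 : ℕ).factorial : ℝ) ^ 2 := by norm_num
    | succ k =>
      rw [iteratedDeriv_succ', hP, gstep_prim_deriv]
      have hk := gstep_density_abs_iteratedDeriv_le k x
      have hmono : (18 : ℝ) ^ k * (k.factorial : ℝ) ^ 2 ≤ 18 ^ (k + 1) * ((k + 1).factorial : ℝ) ^ 2 := by
        have h1 : (18 : ℝ) ^ k ≤ 18 ^ (k + 1) := pow_le_pow_right₀ (by norm_num) (Nat.le_succ k)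
        have h2 : (k.factorial : ℝ) ≤ ((k + 1).factorial : ℝ) := by exact_mod_cast Nat.factorial_le (Nat.le_succ k)
        have h3 : (0 : ℝ) ≤ k.factorial := Nat.cast_nonneg _
        gcongr
      calc I⁻¹ * |iteratedDeriv k (fun x => expNegInvGlue x * expNegInvGlue (1 - x)) x|
          ≤ 2 ^ 14 * (18 ^ (k + 1) * ((k + 1).factorial : ℝ) ^ 2) :=
            mul_le_mul gstep_inv_prim_one_le (hk.trans hmono) (abs_nonneg _) (by norm_num)
        _ = 2 ^ 14 * 18 ^ (k + 1) * ((k + 1).factorial : ℝ) ^ 2 := by ring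

end Summit.QuantumFields.YangMills.Theorems.ContinuumLegGivenGap

end
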